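import Summits.QuantumFields.BalabanUV.T4Continuum.Support.NE9HoloFamilyOfPencil
import Summits.QuantumFields.BalabanUV.T4Continuum.Support.NE9FutureProfileEndOfRecordSharp
import Summits.QuantumFields.BalabanUV.T4Continuum.Support.NE9EndApplied

/-!
# NE9HoloFamilyVacuumSubtracted — ROUTE R4's END ON THE RECORD's OWN NEW-TERM SHAPE: the VACUUM-SUBTRACTED complex slice
# `Q ↦ newTerm act k s U X Q − newTerm act k s U₀ X Q + explZ k U X` has `Ψ ≡ Re Φc` EXACTLY (no re-centring, no `hΨ0`), is
# Fréchet-holomorphic on the table ball and bounded by `(2B + p̄₀)·e^{−κd(X)}` — the END of record's OWN size letter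
# (`hNsucc : p₀ j + 2B ≤ N (j+1)`); with leaf-05's √2-free END the ROOM is `ω̂·s₀ + τ̄·(2B + p̄₀) ≤ θ·s₀`

Cell `pub-balaban`, T4-DAG §6 NE9; BINDER row NE9 OWNER lineage `b2b-balaban-t4-ne9-p1` gen 60, CRUX PROVER NE9 (ruling e34b3e0c (2));
route R4 «fading by Earle–Hamilton» (`t4/ROUTES-NE9.md` v6; refuter PRICING-NE9 v7.0.1 §B′: fragility F-R4-4 «re-centring padding
2B + B_z», NEEDS-CONSTANT «display z = B_z∕B and say whether Ψ ≡ Re newTerm»).  THIS FILE ANSWERS ON THE RECORD's LETTERS: the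
record's new-term map `NE9EndApplied.ΨOf` is `Re newTerm_U − Re newTerm_{U₀} + explZ` ([I] (2.13)–(2.14): the cluster sum minus its
value at the vacuum configuration plus the coupling-free explicit part), so Ψ is NOT `Re newTerm_U` but IS `Re Φc` for the
vacuum-subtracted slice, and the slice budget is `2B + p̄₀` — TWO cluster sums under the same pin budget `B` plus the explicit part's
letter `p₀ k ≤ p̄₀` — exactly the END of record's new-term size budget; no `hΨ0`, no re-centring.  HONEST FRAMING (T4-DAG PAGE 1).
Rung (B)+1 of the FINITE-VOLUME T⁴ programme — NOT infinite volume, NOT a mass gap, NOT Clay.  NE9 (`T4OutputRate.NE9` ∧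
`FadingMemory`) is a cell NEW ESTIMATE, NOT PRINTED in [I] = [Balaban1987RG1] (CMP **109**), [II] = [Balaban1988RG2Cluster] (CMP
**116**), NOT PROVED for Bałaban's E^{(j)}: every theorem below is «NE9 ⇐ the named binders»; the displayed Bałaban-side inputs are
the pencil END's (`hhol`∕`hsup` = (R-0)[scope] «[II] Lemma 3 (2.38) read over Lemma 2's box» on the radius `R₀`, `hkp2`, `hdec`,
`hpin`), the explicit part's size letter `hexplZ` (TYPE [I] (2.14) p. 268 ∕ [II] (2.41) p. 21), the structural binders, the
ℝ-closure of `Adm`, base-free runs; W1 = model O-NE9-1 untouched; spine 0∕9.  HONEST DEPENDENCY (cell line, verbatim): continuum YM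
on T⁴ ⇐ BetaPertH ∧ nine spine estimates (0/9 proved); BetaPertH ⇐ (D1) ∧ (D4) ∧ CAP+tail; G-an2-4 gates asym, D1 and NE2/3/4.
`FlowStep.BetaPertH`, (B), (B^μ) do not occur; [I]∕[II] for TYPES only.
CONTENT ([folklore]; 0 def, 0 sorry): §1 **`ne9_and_fadingMemory_of_holoFamily_sharp`** (the owner's D4 composition re-docked at
leaf-05's `NE9FutureProfileEndOfRecordSharp.ne9_and_fadingMemory_of_holoSlice_sharp`: room `ω̂·r + τ̄·B₁ ≤ θ·r`);
§2 **`ne9_and_fadingMemory_of_pencil_EH_vac`** (abstract conjugation) and **`…_vac_star`** (Mathlib's `star`): the pencil END's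
hypotheses with `hΨ`∕`hΨ0` REPLACED by the record's shape `hΨv : Ψ k s P U X = Re newTerm_U (reading P) − Re newTerm_{U₀} (reading P)
+ explZ k U X` and the letter `hexplZ`, room `ω̂·s₀ + τ̄·(2B + p̄₀) ≤ θ·s₀` ⇒ `NE9 ∧ FadingMemory` with
`prodModuli ((2∕(1−θ))·ℓ) (fun _ => 2θ∕(1+θ))`; §3 junction **`psiOf_eq_vac`** (`rfl`: `NE9EndApplied.ΨOf` HAS the shape `hΨv`) and
**`ne9_and_fadingMemory_of_psiOf_star`** (the END at `Ψ := ΨOf G act wt U₀ explZ`, `hΨv` discharged).  DISGUISE TEST: composition;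
nothing of Bałaban's asserted.  References (TYPES only): [Balaban1987RG1] CMP **109** (2.13)–(2.14) p. 268, (0.23) p. 256;
[Balaban1988RG2Cluster] CMP **116** (2.13)–(2.15) pp. 14–15, Lemma 3 (2.38) p. 20, (2.40)–(2.41) p. 21, (1.36) p. 9;
[KoteckyPreiss1986] p. 492–493; [Chae1985] Thm 14.9; [EarleHamilton1970].
-/

noncomputable section

namespace Summit.QuantumFields.BalabanUV.T4Continuum.NE9HoloFamilyVacuumSubtracted

open Metric Set ComplexConjugate
open scoped BigOperators ENNReal
open Literature.Probability.LatticeModels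
open Literature.MathematicalPhysics.QuantumFieldTheory.Balaban1983to89
open Literature.MathematicalPhysics.QuantumFieldTheory.Balaban1983to89.T4OutputRate
open Literature.MathematicalPhysics.QuantumFieldTheory.Balaban1983to89.T4ActivityLipschitz
open Literature.MathematicalPhysics.QuantumFieldTheory.Balaban1983to89.T4HistoryLipschitzRecursion
open Literature.MathematicalPhysics.QuantumFieldTheory.Balaban1983to89.T4HistoryLipschitzOuter
open Literature.MathematicalPhysics.QuantumFieldTheory.Balaban1983to89.T4HistoryLipschitzActivity
open Literature.MathematicalPhysics.QuantumFieldTheory.Balaban1983to89.T4HistoryLipschitzSegment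
open Literature.MathematicalPhysics.QuantumFieldTheory.Balaban1983to89.T4HistoryLipschitzActivity (ClusterGeom)
open Summit.QuantumFields.BalabanUV.T4Continuum.NE9TableReading
open Summit.QuantumFields.BalabanUV.T4Continuum.NE9TwoPointKPOfPencil
open Summit.QuantumFields.BalabanUV.T4Continuum.NE9FutureProfileRecordPrelim
open Summit.QuantumFields.BalabanUV.T4Continuum.NE9HoloSliceOfFamily
open Summit.QuantumFields.BalabanUV.T4Continuum.NE9HoloFamilyOfPencil
open Summit.QuantumFields.BalabanUV.T4Continuum.NE9FutureProfileReal
open Summit.QuantumFields.BalabanUV.T4Continuum.NE9FutureProfileEndOfRecordSharp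

variable {C : Carriers} (G : ClusterGeom C) {Bg : Type}

section End

variable {ι : Type} [Nonempty ι] {E : Functional C Bg} {W : Set (ℕ → ℝ)} {Adm : Set (Bg → C.Dom → ℝ)}
  {T : ℕ → (ℕ → ℝ) → (Bg → C.Dom → ℝ) → ι → ℝ} {Ψ : ℕ → ℝ → (ι → ℝ) → Bg → C.Dom → ℝ}
  {κ : ℝ} {wt : ℕ → ι → ℝ} {τ : ℕ → ℕ → ℝ} {τbar ω ωh : ℝ}

/-! ## §1 The composed END with leaf-05's √2-free reading constant -/

omit G in
/-- **ROUTE R4's END AT THE RECORD FROM A COMPLEX FAMILY MAP, ROOM `ω̂·r + τ̄·B₁ ≤ θ·r`** — the owner's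
`NE9HoloSliceOfFamily.ne9_and_fadingMemory_of_holoFamily` (structural binders + conjugation `σ` + per-coordinate (c-holo)∕(c-size)
`B₁`∕(c-real)) composed with leaf-05's √2-free END `NE9FutureProfileEndOfRecordSharp.ne9_and_fadingMemory_of_holoSlice_sharp`
instead of the √2 END: same conclusion `NE9 E W κ (prodModuli ((2∕(1−θ))·ℓ) (fun _ => 2θ∕(1+θ))) ∧ FadingMemory …`.
[cite: Balaban1988RG2Cluster, (2.13)-(2.15) pp.14-15 and (1.36) p.9] -/
theorem ne9_and_fadingMemory_of_holoFamily_sharp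
    (h0 : ∀ g ∈ W, ∀ (U : Bg) (X : C.Dom), C.scale X = 0 → E g U X = 0)
    (hAdm : AdmissibleTerms E W Adm) (hres : AdmRestrict Adm) (hadd : ChannelAdditive Adm T) (hloc : ChannelLocal Adm T)
    (hstep : ChannelSizeAtStepNN Adm T κ wt τ) (hfac : Factorises E W T Ψ) {lam : ℕ → ℝ}
    (hlast : LastCouplingLipschitz E W T Ψ κ lam)
    (hsmul : ∀ (c : ℝ), ∀ H ∈ Adm, c • H ∈ Adm) (hne : Adm.Nonempty) (hwt : ∀ m y, 0 < wt m y)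
    (hτ : ∀ k j, j ≤ k → 0 ≤ τ k j ∧ τ k j ≤ τbar * ω ^ (k - j)) (hτbar : 0 < τbar) (hω : 0 ≤ ω) (hωh : 0 < ωh)
    (hωωh : ω ≤ ωh) {σ : lp (fun _ : ι => ℂ) ∞ →L[ℝ] lp (fun _ : ι => ℂ) ∞}
    (hσ : ∀ (c : ℂ) (x : lp (fun _ : ι => ℂ) ∞), σ (c • x) = conj c • σ x) (hiso : ∀ x, ‖σ x‖ = ‖x‖)
    (hfixρ : ∀ (k : ℕ) (P : ι → ℝ), σ (reading (wt k) P) = reading (wt k) P)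
    {Φc : ℕ → ℝ → lp (fun _ : ι => ℂ) ∞ → Bg → C.Dom → ℂ} {r B₁ θ ℓ : ℝ} (hr : 0 < r) (hB₁ : 0 ≤ B₁) (hθ0 : 0 < θ)
    (hθ1 : θ < 1) (hℓ : 0 ≤ ℓ)
    (hcd : ∀ k, ∀ g ∈ W, ∀ (U : Bg) (X : C.Dom), C.scale X = k + 1 →
      DifferentiableOn ℂ (fun Q => Φc k (g k) Q U X) (ball 0 r))
    (hcb : ∀ k, ∀ g ∈ W, ∀ (U : Bg) (X : C.Dom), C.scale X = k + 1 →
      ∀ Q ∈ ball (0 : lp (fun _ : ι => ℂ) ∞) r, ‖Φc k (g k) Q U X‖ ≤ Real.exp (-(κ * C.d X)) * B₁)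
    (hcre : ∀ k, ∀ g ∈ W, ∀ s ∈ W, ∀ (U : Bg) (X : C.Dom), C.scale X = k + 1 →
      Ψ k (s k) (T k s (E g)) U X = (Φc k (s k) (reading (wt k) (T k s (E g))) U X).re)
    (hroom : ωh * r + τbar * B₁ ≤ θ * r) (hlam : ∀ k, lam k ≤ ℓ) :
    NE9 E W κ (prodModuli (2 / (1 - θ) * ℓ) fun _ => 2 * θ / (1 + θ)) ∧
      FadingMemory (2 / (1 - θ) * ℓ / (2 * θ / (1 + θ))) (2 * θ / (1 + θ))
        (prodModuli (2 / (1 - θ) * ℓ) fun _ => 2 * θ / (1 + θ)) :=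
  ne9_and_fadingMemory_of_holoSlice_sharp h0 hAdm hres hadd hloc hstep hfac hlast hsmul hne hwt hτ hτbar hω hωh hωωh
    (ΦY := holoSlice κ σ Φc) hr hB₁ hθ0 hθ1 hℓ
    (fun k g hg => holoSlice_differentiableOn hσ hiso hB₁ (hcd k g hg) (hcb k g hg))
    (fun k g hg => holoSlice_mapsTo hσ hiso hB₁ (hcd k g hg) (hcb k g hg))
    (holoSlice_real hσ hiso hfixρ hB₁ hcd hcb hcre) hroom hlam

/-! ## §2 THE END OF ROUTE R4 ON THE VACUUM-SUBTRACTED SLICE -/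

/-- **ROUTE R4's END OF RECORD ON THE RECORD's NEW-TERM SHAPE (vacuum-subtracted slice; abstract conjugation).**  Hypotheses: the
END of record's structural binders as in the pencil END `NE9TwoPointKPOfPencil.ne9_and_fadingMemory_of_lineHolo_ball_perStep` and
its PENCIL DATA VERBATIM (`hhol` line-holomorphy of every activity on `‖Q‖ < R₀` at EVERY background — in particular at the vacuum
configuration `U₀` —, `hsup` the majorant on that ball, `hkp2`, `hdec`, `hpin` with budget `B`); INSTEAD of `hΨ`∕`hΨ0`: the record's
SHAPE `hΨv` («new term = Re of the cluster sum at `U` minus Re of the cluster sum at `U₀` plus the coupling-free explicit part», [I]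
(2.13)–(2.14); `NE9EndApplied.ΨOf` by `rfl`, §3) and the explicit part's size letter `hexplZ` (`|explZ k U X| ≤ e^{−κd(X)}·p₀ k`,
`p₀ k ≤ p̄₀`); PLUS the admissible class closed under real scalars, a conjugation `σ` of the table space fixing the weighted readings
of real tables, and the ROOM `ω̂·s₀ + τ̄·(2B + p̄₀) ≤ θ·s₀` on an inner radius `0 < s₀ < R₀`, `0 < θ < 1`, `ω ≤ ω̂`.  The slice is
`Φc := newTerm_U Q − newTerm_{U₀} Q + explZ`: (c-real) holds EXACTLY, (c-size) with `2B + p̄₀` = the END of record's new-term budget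
(`hNsucc : p₀ j + 2B ≤ N (j+1)`).  Conclusion: `NE9 E W κ (prodModuli ((2∕(1−θ))·ℓ) (fun _ => 2θ∕(1+θ))) ∧ FadingMemory …`.
[cite: Balaban1987RG1, (2.13)-(2.14) p.268; Balaban1988RG2Cluster, Lemma 3 (2.38) p.20 and (2.40)-(2.41) p.21; EarleHamilton1970, Theorem] -/
theorem ne9_and_fadingMemory_of_pencil_EH_vac
    (h0 : ∀ g ∈ W, ∀ (U : Bg) (X : C.Dom), C.scale X = 0 → E g U X = 0)
    (hAdm : AdmissibleTerms E W Adm) (hres : AdmRestrict Adm) (hadd : ChannelAdditive Adm T) (hloc : ChannelLocal Adm T)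
    (hstep : ChannelSizeAtStepNN Adm T κ wt τ) (hfac : Factorises E W T Ψ) {lam : ℕ → ℝ}
    (hlast : LastCouplingLipschitz E W T Ψ κ lam)
    (hsmul : ∀ (c : ℝ), ∀ H ∈ Adm, c • H ∈ Adm) (hne : Adm.Nonempty) (hwt : ∀ m y, 0 < wt m y)
    (hτ : ∀ k j, j ≤ k → 0 ≤ τ k j ∧ τ k j ≤ τbar * ω ^ (k - j)) (hτbar : 0 < τbar) (hω : 0 ≤ ω) (hωh : 0 < ωh)
    (hωωh : ω ≤ ωh) {σ : lp (fun _ : ι => ℂ) ∞ →L[ℝ] lp (fun _ : ι => ℂ) ∞}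
    (hσ : ∀ (c : ℂ) (x : lp (fun _ : ι => ℂ) ∞), σ (c • x) = conj c • σ x) (hiso : ∀ x, ‖σ x‖ = ‖x‖)
    (hfixρ : ∀ (k : ℕ) (P : ι → ℝ), σ (reading (wt k) P) = reading (wt k) P)
    {act : ℕ → ℝ → Bg → lp (fun _ : ι => ℂ) ∞ → G.P → ℂ} {m : ℕ → ℝ → Bg → G.P → ℝ} {a d : G.P → ℝ}
    {δ : C.Dom → ℝ} {U₀ : Bg} {explZ : ℕ → Bg → C.Dom → ℝ} {p₀ : ℕ → ℝ} {R₀ s₀ B pbar θ ℓ : ℝ}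
    (ha : ∀ γ, 0 ≤ a γ) (hd : ∀ γ, 0 ≤ d γ) (hs₀ : 0 < s₀) (hsR : s₀ < R₀)
    (hB : 0 ≤ B) (hpbar : 0 ≤ pbar) (hθ0 : 0 < θ) (hθ1 : θ < 1) (hℓ : 0 ≤ ℓ)
    (hhol : ∀ g ∈ W, ∀ (k : ℕ) (U : Bg) (X : C.Dom), C.scale X = k + 1 →
      ∀ γ ∈ G.vol X, LineHolo (fun Q => act k (g k) U Q γ) R₀)
    (hsup : ∀ g ∈ W, ∀ (k : ℕ) (U : Bg) (X : C.Dom), C.scale X = k + 1 →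
      ∀ Q ∈ ball (0 : lp (fun _ : ι => ℂ) ∞) R₀, ∀ γ ∈ G.vol X, ‖act k (g k) U Q γ‖ ≤ m k (g k) U γ)
    (hkp2 : ∀ g ∈ W, ∀ (k : ℕ) (U : Bg) (X : C.Dom), C.scale X = k + 1 →
      ∀ γ ∈ G.vol X, ∑ γ' ∈ G.vol X with G.inc γ' γ, 2 * m k (g k) U γ' * Real.exp (a γ' + d γ') ≤ a γ)
    (hdec : G.DecayExtract δ d) (hpin : G.PinBudget a δ (fun _ => B) κ)
    (hΨv : ∀ (k : ℕ) (s : ℝ) (P : ι → ℝ) (U : Bg) (X : C.Dom),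
      Ψ k s P U X = (G.newTerm act k s U X (reading (wt k) P)).re - (G.newTerm act k s U₀ X (reading (wt k) P)).re +
        explZ k U X)
    (hexplZ : ∀ (k : ℕ) (U : Bg) (X : C.Dom), C.scale X = k + 1 → |explZ k U X| ≤ Real.exp (-(κ * C.d X)) * p₀ k)
    (hp₀ : ∀ k, p₀ k ≤ pbar)
    (hroom : ωh * s₀ + τbar * (2 * B + pbar) ≤ θ * s₀) (hlam : ∀ k, lam k ≤ ℓ) :
    NE9 E W κ (prodModuli (2 / (1 - θ) * ℓ) fun _ => 2 * θ / (1 + θ)) ∧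
      FadingMemory (2 / (1 - θ) * ℓ / (2 * θ / (1 + θ))) (2 * θ / (1 + θ))
        (prodModuli (2 / (1 - θ) * ℓ) fun _ => 2 * θ / (1 + θ)) := by
  -- the complex family map: the VACUUM-SUBTRACTED cluster sum plus the (real, table-free) explicit part
  let Φc : ℕ → ℝ → lp (fun _ : ι => ℂ) ∞ → Bg → C.Dom → ℂ := fun k s Q U X =>
    G.newTerm act k s U X Q - G.newTerm act k s U₀ X Q + ((explZ k U X : ℝ) : ℂ)
  have hball : ball (0 : lp (fun _ : ι => ℂ) ∞) s₀ ⊆ ball 0 R₀ := ball_subset_ball hsR.le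
  have hball' : ball (0 : lp (fun _ : ι => ℂ) ∞) s₀ ⊆ closedBall 0 s₀ := ball_subset_closedBall
  refine ne9_and_fadingMemory_of_holoFamily_sharp h0 hAdm hres hadd hloc hstep hfac hlast hsmul hne hwt hτ hτbar hω hωh hωωh
    hσ hiso hfixρ (Φc := Φc) (r := s₀) (B₁ := 2 * B + pbar) hs₀ (by positivity) hθ0 hθ1 hℓ ?_ ?_ ?_ hroom hlam
  · -- (c-holo): two Fréchet-holomorphic cluster sums and a constant
    intro k g hg U X hX
    exact (((differentiableOn_newTerm G hd (hhol g hg k U X hX) (hsup g hg k U X hX) (hkp2 g hg k U X hX)).mono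
      hball).sub ((differentiableOn_newTerm G hd (hhol g hg k U₀ X hX) (hsup g hg k U₀ X hX)
        (hkp2 g hg k U₀ X hX)).mono hball)).add (differentiableOn_const _)
  · -- (c-size): pin budget twice + the explicit part's letter
    intro k g hg U X hX Q hQ
    have h1 := norm_newTerm_le_of_pencil G ha hd hsR hhol hsup hkp2 hdec hpin hg (U := U) hX (hball' hQ)
    have h2 := norm_newTerm_le_of_pencil G ha hd hsR hhol hsup hkp2 hdec hpin hg (U := U₀) hX (hball' hQ)
    have h3 := (hexplZ k U X hX).trans (mul_le_mul_of_nonneg_left (hp₀ k) (Real.exp_pos _).le)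
    calc ‖Φc k (g k) Q U X‖
        ≤ ‖G.newTerm act k (g k) U X Q‖ + ‖G.newTerm act k (g k) U₀ X Q‖ + ‖((explZ k U X : ℝ) : ℂ)‖ :=
          (norm_add_le _ _).trans (add_le_add (norm_sub_le _ _) le_rfl)
      _ ≤ B * Real.exp (-(κ * C.d X)) + B * Real.exp (-(κ * C.d X)) + Real.exp (-(κ * C.d X)) * pbar := by
          refine add_le_add (add_le_add h1 h2) ?_
          rw [Complex.norm_real, Real.norm_eq_abs]
          exact h3
      _ = Real.exp (-(κ * C.d X)) * (2 * B + pbar) := by ring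
  · -- (c-real): EXACT — the record's new term IS the real part of the vacuum-subtracted slice at the record's tables
    intro k g _ s _ U X _
    rw [hΨv]
    simp only [Φc, Complex.add_re, Complex.sub_re, Complex.ofReal_re]

/-- **ROUTE R4's END OF RECORD ON THE RECORD's NEW-TERM SHAPE — `star` INSTANTIATED (no conjugation hypothesis left).**  Displayed
inputs = the pencil END's structural binders and pencil data (`hhol`, `hsup`, `hkp2`, `hdec`, `hpin`) + base-free runs `h0` + `Adm`
closed under real scalars + the record's SHAPE `hΨv` + the letter `hexplZ` (`p₀ k ≤ p̄₀`) + the ROOM `ω̂·s₀ + τ̄·(2B + p̄₀) ≤ θ·s₀`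
(`0 < s₀ < R₀`).  Conclusion: `NE9 ∧ FadingMemory` with `prodModuli ((2∕(1−θ))·ℓ) (fun _ => 2θ∕(1+θ))`.  «NE9 ⇐ the named
binders».  Compare `NE9HoloFamilyOfPencil.ne9_and_fadingMemory_of_pencil_EH_star` (room `ω̂·s₀ + (√2·τ̄)·(2B + B_z) ≤ θ·s₀` with a
RE-CENTRED slice and `hΨ0`): here NO re-centring and NO `hΨ0`; the `2B` is the vacuum subtraction, the END of record's own letter.
[cite: Balaban1987RG1, (2.13)-(2.14) p.268; Balaban1988RG2Cluster, Lemma 3 (2.38) p.20 and (2.40)-(2.41) p.21; EarleHamilton1970, Theorem] -/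
theorem ne9_and_fadingMemory_of_pencil_EH_vac_star
    (h0 : ∀ g ∈ W, ∀ (U : Bg) (X : C.Dom), C.scale X = 0 → E g U X = 0)
    (hAdm : AdmissibleTerms E W Adm) (hres : AdmRestrict Adm) (hadd : ChannelAdditive Adm T) (hloc : ChannelLocal Adm T)
    (hstep : ChannelSizeAtStepNN Adm T κ wt τ) (hfac : Factorises E W T Ψ) {lam : ℕ → ℝ}
    (hlast : LastCouplingLipschitz E W T Ψ κ lam)
    (hsmul : ∀ (c : ℝ), ∀ H ∈ Adm, c • H ∈ Adm) (hne : Adm.Nonempty) (hwt : ∀ m y, 0 < wt m y)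
    (hτ : ∀ k j, j ≤ k → 0 ≤ τ k j ∧ τ k j ≤ τbar * ω ^ (k - j)) (hτbar : 0 < τbar) (hω : 0 ≤ ω) (hωh : 0 < ωh)
    (hωωh : ω ≤ ωh)
    {act : ℕ → ℝ → Bg → lp (fun _ : ι => ℂ) ∞ → G.P → ℂ} {m : ℕ → ℝ → Bg → G.P → ℝ} {a d : G.P → ℝ}
    {δ : C.Dom → ℝ} {U₀ : Bg} {explZ : ℕ → Bg → C.Dom → ℝ} {p₀ : ℕ → ℝ} {R₀ s₀ B pbar θ ℓ : ℝ}
    (ha : ∀ γ, 0 ≤ a γ) (hd : ∀ γ, 0 ≤ d γ) (hs₀ : 0 < s₀) (hsR : s₀ < R₀)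
    (hB : 0 ≤ B) (hpbar : 0 ≤ pbar) (hθ0 : 0 < θ) (hθ1 : θ < 1) (hℓ : 0 ≤ ℓ)
    (hhol : ∀ g ∈ W, ∀ (k : ℕ) (U : Bg) (X : C.Dom), C.scale X = k + 1 →
      ∀ γ ∈ G.vol X, LineHolo (fun Q => act k (g k) U Q γ) R₀)
    (hsup : ∀ g ∈ W, ∀ (k : ℕ) (U : Bg) (X : C.Dom), C.scale X = k + 1 →
      ∀ Q ∈ ball (0 : lp (fun _ : ι => ℂ) ∞) R₀, ∀ γ ∈ G.vol X, ‖act k (g k) U Q γ‖ ≤ m k (g k) U γ)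
    (hkp2 : ∀ g ∈ W, ∀ (k : ℕ) (U : Bg) (X : C.Dom), C.scale X = k + 1 →
      ∀ γ ∈ G.vol X, ∑ γ' ∈ G.vol X with G.inc γ' γ, 2 * m k (g k) U γ' * Real.exp (a γ' + d γ') ≤ a γ)
    (hdec : G.DecayExtract δ d) (hpin : G.PinBudget a δ (fun _ => B) κ)
    (hΨv : ∀ (k : ℕ) (s : ℝ) (P : ι → ℝ) (U : Bg) (X : C.Dom),
      Ψ k s P U X = (G.newTerm act k s U X (reading (wt k) P)).re - (G.newTerm act k s U₀ X (reading (wt k) P)).re +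
        explZ k U X)
    (hexplZ : ∀ (k : ℕ) (U : Bg) (X : C.Dom), C.scale X = k + 1 → |explZ k U X| ≤ Real.exp (-(κ * C.d X)) * p₀ k)
    (hp₀ : ∀ k, p₀ k ≤ pbar)
    (hroom : ωh * s₀ + τbar * (2 * B + pbar) ≤ θ * s₀) (hlam : ∀ k, lam k ≤ ℓ) :
    NE9 E W κ (prodModuli (2 / (1 - θ) * ℓ) fun _ => 2 * θ / (1 + θ)) ∧
      FadingMemory (2 / (1 - θ) * ℓ / (2 * θ / (1 + θ))) (2 * θ / (1 + θ))
        (prodModuli (2 / (1 - θ) * ℓ) fun _ => 2 * θ / (1 + θ)) := by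
  obtain ⟨σ, hσa, hσ, hiso⟩ := exists_star_clm_lp (ι := ι)
  exact ne9_and_fadingMemory_of_pencil_EH_vac G h0 hAdm hres hadd hloc hstep hfac hlast hsmul hne hwt hτ hτbar hω hωh hωωh hσ
    hiso (fun k P => by rw [hσa]; exact (isSelfAdjoint_reading (wt k) P).star_eq) ha hd hs₀ hsR hB hpbar hθ0 hθ1 hℓ hhol hsup
    hkp2 hdec hpin hΨv hexplZ hp₀ hroom hlam

end End

/-! ## §3 Junction with the record: `NE9EndApplied.ΨOf` HAS the vacuum-subtracted shape -/

section Record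

open Summit.QuantumFields.BalabanUV.T4Continuum.NE9EndApplied
open Summit.QuantumFields.BalabanUV.T4Continuum.NE9ComplexEncoding (doubleCarriers)

variable {C₀ : Carriers} {E : Type} {ι : Type}

omit G in
/-- [folklore] **THE RECORD's NEW-TERM MAP IS VACUUM-SUBTRACTED, LITERALLY**: `ΨOf G act wt U₀ explZ k s Q U X =
Re newTerm_U (reading (wt k) Q) − Re newTerm_{U₀} (reading (wt k) Q) + explZ k U X` — by `rfl` (`readingρ wt k = reading (wt k)`).
So at the record Ψ is NOT `Re newTerm_U` (refuter PRICING v7.0.1 §B′ NEEDS-CONSTANT, answered): the `U₀` cluster sum is read at the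
SAME table. [cite: Balaban1987RG1, (2.13)-(2.14) p.268] -/
theorem psiOf_eq_vac (G : ClusterGeom (doubleCarriers C₀)) (act : ℕ → ℝ → E → lp (fun _ : ι => ℂ) ∞ → G.P → ℂ)
    (wt : ℕ → ι → ℝ) (U₀ : E) (explZ : ℕ → E → (doubleCarriers C₀).Dom → ℝ) (k : ℕ) (s : ℝ) (Q : ι → ℝ) (U : E)
    (X : (doubleCarriers C₀).Dom) :
    ΨOf G act wt U₀ explZ k s Q U X =
      (G.newTerm act k s U X (reading (wt k) Q)).re - (G.newTerm act k s U₀ X (reading (wt k) Q)).re + explZ k U X :=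
  rfl

omit G in
/-- **ROUTE R4's END AT THE RECORD's OWN NEW-TERM MAP `ΨOf`** — `ne9_and_fadingMemory_of_pencil_EH_vac_star` at
`Ψ := NE9EndApplied.ΨOf G act wt U₀ explZ` (the shape hypothesis discharged by `rfl`): for ANY functional `Ef` on the re∕im-doubled
carriers factorising through a channel `T` with this new-term map (e.g. the defined functional `EfOf …`, `NE9EndApplied.factorises_EfOf`),
the pencil data + `hexplZ` + structural binders + the ROOM `ω̂·s₀ + τ̄·(2B + p̄₀) ≤ θ·s₀` ⇒ `NE9 Ef W κ (prodModuli ((2∕(1−θ))·ℓ)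
(fun _ => 2θ∕(1+θ))) ∧ FadingMemory …`.  «NE9 ⇐ the named binders»; nothing of Bałaban's asserted.
[cite: Balaban1987RG1, (2.13)-(2.14) p.268 and (0.23) p.256; Balaban1988RG2Cluster, Lemma 3 (2.38) p.20 and (2.40)-(2.41) p.21; EarleHamilton1970, Theorem] -/
theorem ne9_and_fadingMemory_of_psiOf_star [Nonempty ι] (G : ClusterGeom (doubleCarriers C₀))
    {Ef : Functional (doubleCarriers C₀) E} {W : Set (ℕ → ℝ)} {Adm : Set (E → (doubleCarriers C₀).Dom → ℝ)}
    {T : ℕ → (ℕ → ℝ) → (E → (doubleCarriers C₀).Dom → ℝ) → ι → ℝ} {κ : ℝ} {wt : ℕ → ι → ℝ} {τ : ℕ → ℕ → ℝ}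
    {τbar ω ωh : ℝ} {act : ℕ → ℝ → E → lp (fun _ : ι => ℂ) ∞ → G.P → ℂ} {U₀ : E}
    {explZ : ℕ → E → (doubleCarriers C₀).Dom → ℝ}
    (h0 : ∀ g ∈ W, ∀ (U : E) (X : (doubleCarriers C₀).Dom), (doubleCarriers C₀).scale X = 0 → Ef g U X = 0)
    (hAdm : AdmissibleTerms Ef W Adm) (hres : AdmRestrict Adm) (hadd : ChannelAdditive Adm T) (hloc : ChannelLocal Adm T)
    (hstep : ChannelSizeAtStepNN Adm T κ wt τ) (hfac : Factorises Ef W T (ΨOf G act wt U₀ explZ)) {lam : ℕ → ℝ}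
    (hlast : LastCouplingLipschitz Ef W T (ΨOf G act wt U₀ explZ) κ lam)
    (hsmul : ∀ (c : ℝ), ∀ H ∈ Adm, c • H ∈ Adm) (hne : Adm.Nonempty) (hwt : ∀ m y, 0 < wt m y)
    (hτ : ∀ k j, j ≤ k → 0 ≤ τ k j ∧ τ k j ≤ τbar * ω ^ (k - j)) (hτbar : 0 < τbar) (hω : 0 ≤ ω) (hωh : 0 < ωh)
    (hωωh : ω ≤ ωh) {m : ℕ → ℝ → E → G.P → ℝ} {a d : G.P → ℝ} {δ : (doubleCarriers C₀).Dom → ℝ} {p₀ : ℕ → ℝ}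
    {R₀ s₀ B pbar θ ℓ : ℝ} (ha : ∀ γ, 0 ≤ a γ) (hd : ∀ γ, 0 ≤ d γ) (hs₀ : 0 < s₀) (hsR : s₀ < R₀)
    (hB : 0 ≤ B) (hpbar : 0 ≤ pbar) (hθ0 : 0 < θ) (hθ1 : θ < 1) (hℓ : 0 ≤ ℓ)
    (hhol : ∀ g ∈ W, ∀ (k : ℕ) (U : E) (X : (doubleCarriers C₀).Dom), (doubleCarriers C₀).scale X = k + 1 →
      ∀ γ ∈ G.vol X, LineHolo (fun Q => act k (g k) U Q γ) R₀)
    (hsup : ∀ g ∈ W, ∀ (k : ℕ) (U : E) (X : (doubleCarriers C₀).Dom), (doubleCarriers C₀).scale X = k + 1 →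
      ∀ Q ∈ ball (0 : lp (fun _ : ι => ℂ) ∞) R₀, ∀ γ ∈ G.vol X, ‖act k (g k) U Q γ‖ ≤ m k (g k) U γ)
    (hkp2 : ∀ g ∈ W, ∀ (k : ℕ) (U : E) (X : (doubleCarriers C₀).Dom), (doubleCarriers C₀).scale X = k + 1 →
      ∀ γ ∈ G.vol X, ∑ γ' ∈ G.vol X with G.inc γ' γ, 2 * m k (g k) U γ' * Real.exp (a γ' + d γ') ≤ a γ)
    (hdec : G.DecayExtract δ d) (hpin : G.PinBudget a δ (fun _ => B) κ)
    (hexplZ : ∀ (k : ℕ) (U : E) (X : (doubleCarriers C₀).Dom), (doubleCarriers C₀).scale X = k + 1 →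
      |explZ k U X| ≤ Real.exp (-(κ * (doubleCarriers C₀).d X)) * p₀ k)
    (hp₀ : ∀ k, p₀ k ≤ pbar)
    (hroom : ωh * s₀ + τbar * (2 * B + pbar) ≤ θ * s₀) (hlam : ∀ k, lam k ≤ ℓ) :
    NE9 Ef W κ (prodModuli (2 / (1 - θ) * ℓ) fun _ => 2 * θ / (1 + θ)) ∧
      FadingMemory (2 / (1 - θ) * ℓ / (2 * θ / (1 + θ))) (2 * θ / (1 + θ))
        (prodModuli (2 / (1 - θ) * ℓ) fun _ => 2 * θ / (1 + θ)) :=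
  ne9_and_fadingMemory_of_pencil_EH_vac_star G h0 hAdm hres hadd hloc hstep hfac hlast hsmul hne hwt hτ hτbar hω hωh hωωh
    ha hd hs₀ hsR hB hpbar hθ0 hθ1 hℓ hhol hsup hkp2 hdec hpin (fun k s Q U X => psiOf_eq_vac G act wt U₀ explZ k s Q U X)
    hexplZ hp₀ hroom hlam

end Record

end Summit.QuantumFields.BalabanUV.T4Continuum.NE9HoloFamilyVacuumSubtracted

end
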